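import Mathlib.MeasureTheory.Function.ConditionalExpectation.Real
import Mathlib.MeasureTheory.Function.ConditionalExpectation.PullOut
import Mathlib.Algebra.QuadraticDiscriminant
import HarnessLib

/-!
# Explained variance and the L² form of the law of total covariance through a sub-σ-algebra

Topic `Literature/Probability/Moments` (kind proof; no new notions).  Companion of
`TotalCovarianceCondExp.lean` (law of total covariance, LOWER form, with OSCILLATION data: conditional
means a.e. within `ε₁, ε₂` of constants) in the same namespace.  Here the error term of the law of total
covariance is controlled in `L²` instead of `L^∞`, and the variance of a conditional expectation is
bounded BELOW by the variance it explains: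

* `sq_cov_le_var_mul_var` — Cauchy–Schwarz for the covariance of two a.e.-bounded variables on a
  probability space: `Cov(u,w)² ≤ Var(u) Var(w)` (discriminant of `t ↦ ∫ (t(u-ū) - (w-w̄))²`).
* `sq_cov_le_var_condExp_mul_var` — **explained variance**: for `m ≤ m₀`, `f` a.e.-bounded and `g`
  `m`-measurable a.e.-bounded, `Cov(f,g)² ≤ Var(μ[f|m]) · Var(g)`: the variance of the conditional
  expectation dominates the squared covariance of `f` with ANY `m`-measurable variable over that
  variable's variance (`Cov(f,g) = Cov(μ[f|m], g)` by the pull-out property and `∫ μ[f|m] = ∫ f`, then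
  Cauchy–Schwarz; Durrett 2019 §4.1, Thm 4.1.15 / Ex. 4.1.7: `μ[f|m]` is the `L²`-projection).
* `var_condExp_le_var` — `Var(μ[f|m]) ≤ Var(f)` (`∫ μ[f|m]² = ∫ μ[f|m]·f ≤ (∫ μ[f|m]²)^{1/2}(∫ f²)^{1/2}`).
* `sq_cov_sub_integral_condCov_le` — **law of total covariance, `L²` form**:
  `(Cov(f,g) - E[Cov(f,g|m)])² ≤ Var(μ[f|m]) · Var(μ[g|m])`, where `E[Cov(f,g|m)] := ∫ (μ[fg|m] - μ[f|m] μ[g|m])`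
  (the identity `Cov(f,g) = E[Cov(f,g|m)] + Cov(μ[f|m], μ[g|m])` and Cauchy–Schwarz) — so the
  correction to «covariance = mean conditional covariance» is small as soon as the conditional MEANS
  have small variance, with no sup-norm (oscillation) hypothesis.

Consumed by block- and cube-conditioning arguments for lattice gauge theory correlators in the typical
(measure-side) currencies, where `m = σ(exterior of a cube)`: `Summits/QuantumFields/YangMills/Theorems/
BalabanLadderUVSeamRecResponseVarianceFloor.lean` is the kernel (DLR) phrasing of `sq_cov_le_var_condExp_mul_var`.

## Mathlib

We USE `MeasureTheory.integral_condExp`, `integrable_condExp`, `stronglyMeasurable_condExp`,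
`condExp_stronglyMeasurable_mul_of_bound` (pull-out), `ae_bdd_abs_condExp_of_ae_bdd_abs`,
`Integrable.bdd_mul`, `discrim_le_zero`.  Mathlib (pinned) has `ProbabilityTheory.condVar` and
`ProbabilityTheory.covariance` but neither the explained-variance inequality nor a law of total
covariance (searched `condVar`, `covariance_condExp`, `variance_condExp`, `total_covariance`).

## References

* R. Durrett, *Probability: Theory and Examples*, 5th ed. (CUP 2019), §4.1 (Thm 4.1.15: conditional
  expectation as orthogonal projection in `L²`; Ex. 4.1.7: law of total variance).
-/

noncomputable section

open MeasureTheory Filter Topology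

namespace Literature.Probability.Moments

section CauchySchwarz

variable {Ω : Type*} [MeasurableSpace Ω] {μ : Measure Ω}

/-- Integrability of the product of two a.e.-bounded a.e.-strongly-measurable real functions on a finite
measure space. [folklore] -/
private theorem integrable_mul_of_ae_abs_le [IsFiniteMeasure μ] {u w : Ω → ℝ} (hu : AEStronglyMeasurable u μ)
    (hw : AEStronglyMeasurable w μ) {cu cw : ℝ} (hub : ∀ᵐ ω ∂μ, |u ω| ≤ cu) (hwb : ∀ᵐ ω ∂μ, |w ω| ≤ cw) :
    Integrable (fun ω => u ω * w ω) μ := by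
  have hwi : Integrable w μ := Integrable.of_bound hw cw (hwb.mono fun ω h => by rwa [Real.norm_eq_abs])
  exact hwi.bdd_mul hu (hub.mono fun ω h => by rwa [Real.norm_eq_abs])

/-- **Cauchy–Schwarz for a covariance.**  For a.e.-bounded `u, w` on a probability space,
`(∫ uw - ∫ u ∫ w)² ≤ (∫ u² - (∫ u)²) (∫ w² - (∫ w)²)`: the quadratic `t ↦ ∫ (t(u - ū) - (w - w̄))² ≥ 0` has
non-positive discriminant (`discrim_le_zero`). [cite: Durrett2019, §1.5 Thm 1.5.2 (Cauchy–Schwarz)] -/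
theorem sq_cov_le_var_mul_var [IsProbabilityMeasure μ] {u w : Ω → ℝ} (hu : AEStronglyMeasurable u μ)
    (hw : AEStronglyMeasurable w μ) {cu cw : ℝ} (hub : ∀ᵐ ω ∂μ, |u ω| ≤ cu) (hwb : ∀ᵐ ω ∂μ, |w ω| ≤ cw) :
    ((∫ ω, u ω * w ω ∂μ) - (∫ ω, u ω ∂μ) * ∫ ω, w ω ∂μ) ^ 2 ≤
      ((∫ ω, u ω ^ 2 ∂μ) - (∫ ω, u ω ∂μ) ^ 2) * ((∫ ω, w ω ^ 2 ∂μ) - (∫ ω, w ω ∂μ) ^ 2) := by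
  set a := ∫ ω, u ω ∂μ with ha
  set b := ∫ ω, w ω ∂μ with hb
  have hui : Integrable u μ := Integrable.of_bound hu cu (hub.mono fun ω h => by rwa [Real.norm_eq_abs])
  have hwi : Integrable w μ := Integrable.of_bound hw cw (hwb.mono fun ω h => by rwa [Real.norm_eq_abs])
  have huu : Integrable (fun ω => u ω * u ω) μ := integrable_mul_of_ae_abs_le hu hu hub hub
  have hww : Integrable (fun ω => w ω * w ω) μ := integrable_mul_of_ae_abs_le hw hw hwb hwb
  have huw : Integrable (fun ω => u ω * w ω) μ := integrable_mul_of_ae_abs_le hu hw hub hwb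
  -- centred second moments
  set A := (∫ ω, u ω ^ 2 ∂μ) - a ^ 2 with hA
  set B := (∫ ω, u ω * w ω ∂μ) - a * b with hB
  set C := (∫ ω, w ω ^ 2 ∂μ) - b ^ 2 with hC
  have hu2 : ∫ ω, u ω ^ 2 ∂μ = ∫ ω, u ω * u ω ∂μ := integral_congr_ae (ae_of_all _ fun ω => sq (u ω))
  have hw2 : ∫ ω, w ω ^ 2 ∂μ = ∫ ω, w ω * w ω ∂μ := integral_congr_ae (ae_of_all _ fun ω => sq (w ω))
  -- the quadratic `t ↦ ∫ (t (u-a) - (w-b))² = A t² - 2B t + C ≥ 0`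
  have hquad : ∀ t : ℝ, 0 ≤ A * (t * t) + (-2 * B) * t + C := by
    intro t
    have hnn : 0 ≤ ∫ ω, (t * (u ω - a) - (w ω - b)) ^ 2 ∂μ := integral_nonneg fun ω => sq_nonneg _
    have hid : (fun ω => (t * (u ω - a) - (w ω - b)) ^ 2) = fun ω =>
        t ^ 2 * (u ω * u ω) - (2 * t ^ 2 * a - 2 * t * b) * u ω + (2 * t * a - 2 * b) * w ω
          - 2 * t * (u ω * w ω) + w ω * w ω + (t * a - b) ^ 2 := by
      funext ω; ring
    have i1 : Integrable (fun ω => t ^ 2 * (u ω * u ω)) μ := huu.const_mul _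
    have i2 : Integrable (fun ω => (2 * t ^ 2 * a - 2 * t * b) * u ω) μ := hui.const_mul _
    have i3 : Integrable (fun ω => (2 * t * a - 2 * b) * w ω) μ := hwi.const_mul _
    have i4 : Integrable (fun ω => 2 * t * (u ω * w ω)) μ := huw.const_mul _
    have i5 : Integrable (fun ω => w ω * w ω) μ := hww
    have i6 : Integrable (fun _ : Ω => (t * a - b) ^ 2) μ := integrable_const _
    have i12 : Integrable (fun ω => t ^ 2 * (u ω * u ω) - (2 * t ^ 2 * a - 2 * t * b) * u ω) μ := i1.sub i2
    have i123 : Integrable (fun ω => t ^ 2 * (u ω * u ω) - (2 * t ^ 2 * a - 2 * t * b) * u ω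
        + (2 * t * a - 2 * b) * w ω) μ := i12.add i3
    have i1234 : Integrable (fun ω => t ^ 2 * (u ω * u ω) - (2 * t ^ 2 * a - 2 * t * b) * u ω
        + (2 * t * a - 2 * b) * w ω - 2 * t * (u ω * w ω)) μ := i123.sub i4
    have i12345 : Integrable (fun ω => t ^ 2 * (u ω * u ω) - (2 * t ^ 2 * a - 2 * t * b) * u ω
        + (2 * t * a - 2 * b) * w ω - 2 * t * (u ω * w ω) + w ω * w ω) μ := i1234.add i5
    rw [hid, integral_add i12345 i6, integral_add i1234 i5, integral_sub i123 i4, integral_add i12 i3,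
      integral_sub i1 i2, integral_const_mul, integral_const_mul, integral_const_mul, integral_const_mul,
      integral_const, probReal_univ, one_smul, ← ha, ← hb, ← hu2, ← hw2] at hnn
    simp only [hA, hB, hC]
    nlinarith [hnn]
  have hdisc := discrim_le_zero hquad
  unfold discrim at hdisc
  simp only [hA, hB, hC] at hdisc ⊢
  nlinarith [hdisc]

end CauchySchwarz

section CondExp

variable {Ω : Type*} {m m₀ : MeasurableSpace Ω} {μ : Measure Ω}

/-- **Explained variance.**  On a probability space `(Ω, m₀, μ)` with `m ≤ m₀`, let `f` be a.e. bounded and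
a.e. strongly measurable, and `g` be `m`-strongly-measurable and a.e. bounded.  Then
`(∫ fg - ∫ f ∫ g)² ≤ (∫ μ[f|m]² - (∫ f)²) · (∫ g² - (∫ g)²)`, i.e. `Cov(f,g)² ≤ Var(μ[f|m]) Var(g)`: by the
pull-out property `∫ fg = ∫ μ[fg|m] = ∫ g μ[f|m]` and `∫ μ[f|m] = ∫ f`, so `Cov(f,g) = Cov(μ[f|m], g)`, then
Cauchy–Schwarz. [cite: Durrett2019, §4.1 Thm 4.1.15] -/
theorem sq_cov_le_var_condExp_mul_var [IsProbabilityMeasure μ] (hm : m ≤ m₀) {f g : Ω → ℝ}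
    (hf : AEStronglyMeasurable f μ) (hg : StronglyMeasurable[m] g) {cf cg : ℝ}
    (hfb : ∀ᵐ ω ∂μ, |f ω| ≤ cf) (hgb : ∀ᵐ ω ∂μ, |g ω| ≤ cg) :
    ((∫ ω, f ω * g ω ∂μ) - (∫ ω, f ω ∂μ) * ∫ ω, g ω ∂μ) ^ 2 ≤
      ((∫ ω, (μ[f|m]) ω ^ 2 ∂μ) - (∫ ω, f ω ∂μ) ^ 2) * ((∫ ω, g ω ^ 2 ∂μ) - (∫ ω, g ω ∂μ) ^ 2) := by
  set F : Ω → ℝ := μ[f|m] with hF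
  have hFm : AEStronglyMeasurable F μ := (stronglyMeasurable_condExp.mono hm).aestronglyMeasurable
  have hFb : ∀ᵐ ω ∂μ, |F ω| ≤ cf := ae_bdd_abs_condExp_of_ae_bdd_abs hfb
  have hgm : AEStronglyMeasurable g μ := (hg.mono hm).aestronglyMeasurable
  have hfi : Integrable f μ := Integrable.of_bound hf cf (hfb.mono fun ω h => by rwa [Real.norm_eq_abs])
  -- pull-out: `∫ g f = ∫ g μ[f|m]`
  have hpull : μ[g * f|m] =ᵐ[μ] g * F :=
    condExp_stronglyMeasurable_mul_of_bound hm hg hfi cg (hgb.mono fun ω h => by rwa [Real.norm_eq_abs])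
  have h1 : ∫ ω, f ω * g ω ∂μ = ∫ ω, F ω * g ω ∂μ := by
    have e1 : ∫ ω, f ω * g ω ∂μ = ∫ ω, (g * f) ω ∂μ :=
      integral_congr_ae (ae_of_all _ fun ω => by simp [mul_comm])
    rw [e1, ← integral_condExp hm, integral_congr_ae hpull]
    exact integral_congr_ae (ae_of_all _ fun ω => by simp [mul_comm])
  have h2 : ∫ ω, f ω ∂μ = ∫ ω, F ω ∂μ := by rw [hF, integral_condExp hm]
  rw [h1, h2]
  exact sq_cov_le_var_mul_var hFm hgm hFb hgb

/-- **The variance of a conditional expectation is at most the variance**: `∫ μ[f|m]² - (∫ f)² ≤ ∫ f² - (∫ f)²`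
for a.e. bounded `f` (`∫ μ[f|m]² = ∫ μ[f|m] f` by the pull-out property, then Cauchy–Schwarz).
[cite: Durrett2019, §4.1 Thm 4.1.15] -/
theorem var_condExp_le_var [IsProbabilityMeasure μ] (hm : m ≤ m₀) {f : Ω → ℝ}
    (hf : AEStronglyMeasurable f μ) {cf : ℝ} (hfb : ∀ᵐ ω ∂μ, |f ω| ≤ cf) :
    (∫ ω, (μ[f|m]) ω ^ 2 ∂μ) - (∫ ω, f ω ∂μ) ^ 2 ≤ (∫ ω, f ω ^ 2 ∂μ) - (∫ ω, f ω ∂μ) ^ 2 := by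
  set F : Ω → ℝ := μ[f|m] with hF
  have hFsm : StronglyMeasurable[m] F := stronglyMeasurable_condExp
  have hFm : AEStronglyMeasurable F μ := (stronglyMeasurable_condExp.mono hm).aestronglyMeasurable
  have hFb : ∀ᵐ ω ∂μ, |F ω| ≤ cf := ae_bdd_abs_condExp_of_ae_bdd_abs hfb
  have hfi : Integrable f μ := Integrable.of_bound hf cf (hfb.mono fun ω h => by rwa [Real.norm_eq_abs])
  have hpull : μ[F * f|m] =ᵐ[μ] F * F :=
    condExp_stronglyMeasurable_mul_of_bound hm hFsm hfi cf (hFb.mono fun ω h => by rwa [Real.norm_eq_abs])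
  -- `∫ F·F = ∫ F·f` (tower + pull-out)
  have hFF : ∫ ω, F ω * F ω ∂μ = ∫ ω, F ω * f ω ∂μ := by
    calc ∫ ω, F ω * F ω ∂μ = ∫ ω, (F * F) ω ∂μ := integral_congr_ae (ae_of_all _ fun ω => rfl)
      _ = ∫ ω, (μ[F * f|m]) ω ∂μ := (integral_congr_ae hpull).symm
      _ = ∫ ω, (F * f) ω ∂μ := integral_condExp hm
      _ = ∫ ω, F ω * f ω ∂μ := integral_congr_ae (ae_of_all _ fun ω => rfl)
  -- `∫ (F - f)² ≥ 0` gives `2 ∫ F f ≤ ∫ F² + ∫ f²`, i.e. `∫ F² ≤ ∫ f²` using `∫ F² = ∫ F f`.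
  have hFFi : Integrable (fun ω => F ω * F ω) μ := integrable_mul_of_ae_abs_le hFm hFm hFb hFb
  have hffi : Integrable (fun ω => f ω * f ω) μ := integrable_mul_of_ae_abs_le hf hf hfb hfb
  have hFfi : Integrable (fun ω => F ω * f ω) μ := integrable_mul_of_ae_abs_le hFm hf hFb hfb
  have hnn : 0 ≤ ∫ ω, (F ω - f ω) ^ 2 ∂μ := integral_nonneg fun ω => sq_nonneg _
  have hid : (fun ω => (F ω - f ω) ^ 2) = fun ω => F ω * F ω - 2 * (F ω * f ω) + f ω * f ω := by
    funext ω; ring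
  have i12 : Integrable (fun ω => F ω * F ω - 2 * (F ω * f ω)) μ := hFFi.sub (hFfi.const_mul 2)
  rw [hid, integral_add i12 hffi, integral_sub hFFi (hFfi.const_mul 2), integral_const_mul] at hnn
  have e2 : ∫ ω, F ω ^ 2 ∂μ = ∫ ω, F ω * F ω ∂μ := integral_congr_ae (ae_of_all _ fun ω => sq (F ω))
  have e3 : ∫ ω, f ω ^ 2 ∂μ = ∫ ω, f ω * f ω ∂μ := integral_congr_ae (ae_of_all _ fun ω => sq (f ω))
  rw [e2, e3]
  linarith

/-- **Law of total covariance, `L²` form, through a sub-σ-algebra.**  On a probability space with `m ≤ m₀`,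
for a.e. bounded `f, g` (no measurability or integrability hypothesis is needed, by Mathlib's `0`-conventions):
`(∫ fg - ∫ f ∫ g - ∫ (μ[fg|m] - μ[f|m] μ[g|m]))² ≤ (∫ μ[f|m]² - (∫ f)²) · (∫ μ[g|m]² - (∫ g)²)`,
i.e. `|Cov(f,g) - E[Cov(f,g|m)]| ≤ (Var μ[f|m])^{1/2} (Var μ[g|m])^{1/2}`: the exact identity
`Cov(f,g) = E[Cov(f,g|m)] + Cov(μ[f|m], μ[g|m])` (`integral_condExp` three times) and Cauchy–Schwarz for the
covariance of the conditional means.  Compare `total_covariance_lower_bound_condExp` (oscillation form).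
[cite: Durrett2019, §4.1 Ex. 4.1.7] -/
theorem sq_cov_sub_integral_condCov_le [IsProbabilityMeasure μ] (hm : m ≤ m₀) {f g : Ω → ℝ}
    {cf cg : ℝ} (hfb : ∀ᵐ ω ∂μ, |f ω| ≤ cf) (hgb : ∀ᵐ ω ∂μ, |g ω| ≤ cg) :
    ((∫ ω, f ω * g ω ∂μ) - (∫ ω, f ω ∂μ) * (∫ ω, g ω ∂μ)
        - ∫ ω, ((μ[f * g|m]) ω - (μ[f|m]) ω * (μ[g|m]) ω) ∂μ) ^ 2 ≤
      ((∫ ω, (μ[f|m]) ω ^ 2 ∂μ) - (∫ ω, f ω ∂μ) ^ 2) * ((∫ ω, (μ[g|m]) ω ^ 2 ∂μ) - (∫ ω, g ω ∂μ) ^ 2) := by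
  set F : Ω → ℝ := μ[f|m] with hF
  set G : Ω → ℝ := μ[g|m] with hG
  set H : Ω → ℝ := μ[f * g|m] with hH
  have hFm : AEStronglyMeasurable F μ := (stronglyMeasurable_condExp.mono hm).aestronglyMeasurable
  have hGm : AEStronglyMeasurable G μ := (stronglyMeasurable_condExp.mono hm).aestronglyMeasurable
  have hFb : ∀ᵐ ω ∂μ, |F ω| ≤ cf := ae_bdd_abs_condExp_of_ae_bdd_abs hfb
  have hGb : ∀ᵐ ω ∂μ, |G ω| ≤ cg := ae_bdd_abs_condExp_of_ae_bdd_abs hgb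
  have hHi : Integrable H μ := integrable_condExp
  have hFGi : Integrable (fun ω => F ω * G ω) μ := integrable_mul_of_ae_abs_le hFm hGm hFb hGb
  -- the three total-expectation identities
  have h1 : ∫ ω, f ω * g ω ∂μ = ∫ ω, H ω ∂μ := by rw [hH, integral_condExp hm]; rfl
  have h2 : ∫ ω, f ω ∂μ = ∫ ω, F ω ∂μ := by rw [hF, integral_condExp hm]
  have h3 : ∫ ω, g ω ∂μ = ∫ ω, G ω ∂μ := by rw [hG, integral_condExp hm]
  have h4 : ∫ ω, (H ω - F ω * G ω) ∂μ = (∫ ω, H ω ∂μ) - ∫ ω, F ω * G ω ∂μ := integral_sub hHi hFGi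
  have hkey := sq_cov_le_var_mul_var hFm hGm hFb hGb
  have e : (∫ ω, f ω * g ω ∂μ) - (∫ ω, f ω ∂μ) * (∫ ω, g ω ∂μ) - ∫ ω, (H ω - F ω * G ω) ∂μ =
      (∫ ω, F ω * G ω ∂μ) - (∫ ω, F ω ∂μ) * ∫ ω, G ω ∂μ := by
    rw [h4, h1, h2, h3]; ring
  rw [e, h2, h3]
  exact hkey

end CondExp

end Literature.Probability.Moments

end
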